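import Mathlib
import Summits.QuantumFields.YangMills.Theorems.BalabanUVNodesN15BackgroundV1Species
import Summits.QuantumFields.YangMills.Theorems.BalabanUVNodesN15BackgroundLayerEntriesOfLetters
import HarnessLib

/-!
# Route «BalabanUVNodes» (cluster K4 «SpineRates»), Track-A DAG node N15 = spine estimate NE2, BACKGROUND LAYER — `T4EtaRate.NE2PlusOperator` BY NAME WITH THE
# PRINT's OWN FIRST-ORDER PERTURBATION `V′₁(A)` OF (3.52) LIVE (all three terms, both bond orientations, matrix coefficients in coordinates): the four (3.42)
# entries of the non-abelian background-dependent pair on the forward∕backward stack `J ⊕ J`, under the guard, per index with explicit constants, for any family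

Cell `pub-ymgap`, seat `pub-ymgap-dag-n15-c` (generation g2; R134 ACCELERATION SEAT, strategy s1; HUMAN RULING D-0062; chair R424 venue).  `bears_on: R4∕N15`.
Filed `--supports stmt-QuantumFields-19676` (K3; helper).  Imports BY NAME, nothing in the tree modified: this seat's `…N15BackgroundV1Species` (`v1Bg`, `v1coefC`,
`v1coefA`, `v1avg`, `v1Instance`, `v1_letters_of_reg335`) and `…N15BackgroundLayerEntriesOfLetters` (`hasMaj_entries_of_letters`, `entryMajorant_le_etaRateShape`;
through it M1 `bgPairM`∕`unstackM`, B1a∕B3 `bgPropV`, `bgSourceV`, `bgDerivedV`, `stack`, `bgConst`, `bgConst1`, g0's `opFamily`, `etaRateIneq342_of_hasMaj`).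

THE POINT.  G2 read `NE2PlusOperator` out by name with the non-abelian gauge field live through the covariant-DERIVATIVE species `Phi1(η, ad A)∘S` (C1∕G1's model
of (3.50)).  Here the perturbation is the print's own `V′₁(A)` of [Balaban1985BackgroundPropagators] (3.52) p. 400 — `Σ_{b∈st(x)} i[A′(b), (∇λ)(b)] + i[(D*A′)(x), λ(x)]
+ Σ_b F′_{1,k}(i ad_{A′(b)}) λ(b₊)` in the `U ≡ 1` background — which is DIAGONAL on the forward∕backward stack (`…V1Coefficients`): M1's non-abelian pair
`bgPairM G D c a` over the stacked `U ≡ 1` layer `(G, (∇⁺_μG)_μ, (∇⁻_μG)_μ)` (derived pieces indexed by `J ⊕ J`) with the coefficients `c = v1coefC`, `a = v1coefA`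
DERIVED from the configuration `(A⁺, A⁻, W)`; ALL FOUR (3.42) entry operators of its η-difference are bounded under the printed guard `M ≥ M₅`, `M·α₀ ≤ a₀` with the
letters read off `Reg335` — ONE application of `hasMaj_entries_of_letters` to `v1_letters_of_reg335`.  The ONLY displayed hypotheses are the NE2⁰ operator layer
of the `U ≡ 1` pieces on the product carrier, now including the BACKWARD derivative pieces `∇⁻_μG` (their inhabitant at the vector piece, `S_{−ν}∘pieceD1`, is
located, not in the tree: the inhabitation is the sequel).

CONTENTS ([folklore] bookkeeping; 3 defs).  §1 `gV1c35 J κ c₃₅ = 16e(1+|J|)(1+|J ⊕ J|)(1+κ)c₃₅`, `le_gV1c35`; **`hasMaj_v1_entries`**.  §2 `v1Ops4`, `v1Family4`;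
**`etaRateIneq342_v1`** (per index, `B₀ = bgConst + bgConst1` at `gV1c35`, `δ₀ = δ − σ`); **`ne2PlusOperator_v1`** (any family; `M₅ := 1`, `a₀ := (2·gV1c35·(βc_r + 1))⁻¹`).

HONEST FRAMING ∕ LIMITS.  SHAPES of (3.52) in the `U ≡ 1` background; `𝔤 ↦ 𝔄` (complete normed algebra, `ad` = commutator, coordinates `e`); the three input fields
transported independently by fibrewise means (NOT the (C3) nonlinear average); `V′₂` of (3.55)–(3.62) NOT typed; the `U ≡ 1` layer on `J ⊕ J` DISPLAYED; crude
constants; nothing about Bałaban's `G(U)` asserted.  NE2⁺ NOT PRINTED, NOT proved; count-neutral (typed 28∕28; nothing discharged); N15 NOT discharged; one finite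
lattice at fixed ε — NOT infinite volume, NOT OS on ℝ⁴, NOT a mass gap, NOT Clay.
-/

noncomputable section

namespace Summit.QuantumFields.YangMills.BalabanUVNodes.N15.BackgroundLayer

open Literature.MathematicalPhysics.QuantumFieldTheory.Balaban1983to89
open Literature.MathematicalPhysics.QuantumFieldTheory.Balaban1983to89.B11SectG (BlockNorm HasMaj RowSum)
open Literature.MathematicalPhysics.QuantumFieldTheory.Balaban1983to89.T4EtaRate (PairedInstance EtaRateIneq342 NE2PlusOperator rateFactor)
open Literature.MathematicalPhysics.QuantumFieldTheory.Balaban1983to89.T4EtaRateDefect (idef rateWeight)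
open Literature.MathematicalPhysics.QuantumFieldTheory.Balaban1983to89.T4EtaRateCoeffDefect (pull)
open Literature.MathematicalPhysics.QuantumFieldTheory.Balaban1983to89.B6RandomWalk (Triangle254)
open Summit.QuantumFields.YangMills.BalabanUVNodes.N15.OperatorReadout (opGeo opFamily opGeo_len etaRateIneq342_of_hasMaj)
open Summit.QuantumFields.YangMills.BalabanUVNodes.N15.MatrixSpecies (liftMap liftBlk basisConst basisConst_nonneg)

/-! ## §1 The four entries of the `V′₁(A)` pair under the guard -/

section Guard

variable {X X' J ι : Type} [Fintype X] [Fintype X'] [Fintype J] [Fintype ι] [DecidableEq X] [DecidableEq X'] [DecidableEq J] [DecidableEq ι]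
  {𝔄 : Type} [NormedRing 𝔄] [NormedAlgebra ℝ 𝔄] [CompleteSpace 𝔄] (e : 𝔄 ≃L[ℝ] (ι → ℝ)) {g : B6.Geometry} (blk : X → g.Site) (π : X' → X)

/-- THE EFFECTIVE (3.35) CONSTANT of the `V′₁` coefficients: `16e(1 + |J|)(1 + |J ⊕ J|)(1 + κ)·c₃₅` (so the stacked max-row-sum letter `r₂(1+|J ⊕ J|)` of
`v1_letters_of_reg335` is `≤ gV1c35·a₀` under the guard; `κ = κ_e`). [folklore] -/
def gV1c35 (J : Type) [Fintype J] (κ c35 : ℝ) : ℝ := 16 * Real.exp 1 * (1 + Fintype.card J) * (1 + Fintype.card (J ⊕ J)) * (1 + κ) * c35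

omit [Fintype X] [Fintype X'] [DecidableEq X] [DecidableEq X'] [DecidableEq J] in
/-- `c₃₅ ≤ gV1c35` and `0 < gV1c35` for `c₃₅ > 0`, `κ ≥ 0`. [folklore] -/
theorem le_gV1c35 {κ c35 : ℝ} (hκ : 0 ≤ κ) (hc35 : 0 < c35) : c35 ≤ gV1c35 J κ c35 ∧ 0 < gV1c35 J κ c35 := by
  have he : (1 : ℝ) ≤ 16 * Real.exp 1 := by have := Real.add_one_le_exp (1 : ℝ); linarith
  have hJ : (1 : ℝ) ≤ 1 + Fintype.card J := le_add_of_nonneg_right (Nat.cast_nonneg _)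
  have hJJ : (1 : ℝ) ≤ 1 + Fintype.card (J ⊕ J) := le_add_of_nonneg_right (Nat.cast_nonneg _)
  have hk : (1 : ℝ) ≤ 1 + κ := le_add_of_nonneg_right hκ
  have h1 : (1 : ℝ) ≤ 16 * Real.exp 1 * (1 + Fintype.card J) * (1 + Fintype.card (J ⊕ J)) * (1 + κ) :=
    one_le_mul_of_one_le_of_one_le (one_le_mul_of_one_le_of_one_le (one_le_mul_of_one_le_of_one_le he hJ) hJJ) hk
  unfold gV1c35
  constructor
  · nlinarith
  · positivity

variable {G S D₃ : (X × ι → ℝ) →ₗ[ℝ] (X × ι → ℝ)} {D SD : J ⊕ J → (X × ι → ℝ) →ₗ[ℝ] (X × ι → ℝ)} {G' S' D₃' : (X' × ι → ℝ) →ₗ[ℝ] (X' × ι → ℝ)}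
  {D' SD' : J ⊕ J → (X' × ι → ℝ) →ₗ[ℝ] (X' × ι → ℝ)}

/-- **THE FOUR ENTRY DEFECTS OF THE `V′₁(A)` PAIR UNDER THE GUARD.**  `U ≡ 1` layer on the product carrier `X × ι` with derived pieces indexed by the forward∕backward
stack `J ⊕ J` (`D (inl μ) = ∇⁺_μG`, `D (inr μ) = ∇⁻_μG`, and the sources `SD`): majorants `β·e^{−δd}`, the five η-defects `≤ m₀·θ·e^{−δd}`, `σ ≤ δ`; spacings
`0 ≤ η′ ≤ η ≤ 1`, `η ≤ θ`; guard `c₃₅ > 0`, `a₀ ≥ 0`, `2c₃₅a₀ ≤ 1`, `β·(gV1c35·a₀)·c_r ≤ ½`, `M ≥ 1`, `α₀ > 0`, `M·α₀ ≤ a₀`; configuration `U′ = (A⁺, A⁻, W)` with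
`(v1Bg 𝔄 J π M θ).Reg335 c₃₅ α₀ U′`.  With the DERIVED coefficients `(v1coefC e η′ U′, v1coefA e η′ U′)` (fine) and the same at `η`, `v1avg U′` (coarse): entries 0∕1
(components `j : Option (J ⊕ J)` of M1's `bgPairM`), entry 2 (source step), entry 3 (derived object) `≤ {bgConst, bgConst1}(β, c_r, m₀, gV1c35, a₀)·θ·e^{−(δ−σ)d}` — ONE
application of `hasMaj_entries_of_letters`. [cite: Balaban1985BackgroundPropagators, Thm 3.1 (3.42) p.397 (quantifier template, entries: shapes); (3.35) p.396, (3.52) p.400, (3.63)–(3.65) pp.402–403 (shapes, mechanism)] -/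
theorem hasMaj_v1_entries (htri : Triangle254 g) (hd : ∀ a b : g.Site, 0 ≤ g.dist a b) {σ cr : ℝ} (hσ : 0 ≤ σ) (hcr : 0 ≤ cr) (hrow : RowSum g σ cr)
    {δ β m₀ θ c35 a₀ M α₀ η η' : ℝ} (hσδ : σ ≤ δ) (hβ : 0 ≤ β) (hm₀ : 0 ≤ m₀) (hθ : 0 ≤ θ) (hc35 : 0 < c35) (ha₀ : 0 ≤ a₀) (ha₀1 : 2 * (c35 * a₀) ≤ 1)
    (hq : β * (gV1c35 J (basisConst e) c35 * a₀) * cr ≤ 1 / 2) (hM : 1 ≤ M) (hα₀ : 0 < α₀) (hMα : M * α₀ ≤ a₀)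
    (hη' : 0 ≤ η') (hη'η : η' ≤ η) (hη1 : η ≤ 1) (hηθ : η ≤ θ)
    (hG : HasMaj (BlockNorm.ofBlocks g (liftBlk blk ι)) (BlockNorm.ofBlocks g (liftBlk blk ι)) G (fun y y' => β * Real.exp (-(δ * g.dist y y'))))
    (hD : ∀ μ, HasMaj (BlockNorm.ofBlocks g (liftBlk blk ι)) (BlockNorm.ofBlocks g (liftBlk blk ι)) (D μ) (fun y y' => β * Real.exp (-(δ * g.dist y y'))))
    (hG' : HasMaj (BlockNorm.ofBlocks g (liftBlk (blk ∘ π) ι)) (BlockNorm.ofBlocks g (liftBlk (blk ∘ π) ι)) G' (fun y y' => β * Real.exp (-(δ * g.dist y y'))))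
    (hD' : ∀ μ, HasMaj (BlockNorm.ofBlocks g (liftBlk (blk ∘ π) ι)) (BlockNorm.ofBlocks g (liftBlk (blk ∘ π) ι)) (D' μ) (fun y y' => β * Real.exp (-(δ * g.dist y y'))))
    (hS : HasMaj (BlockNorm.ofBlocks g (liftBlk blk ι)) (BlockNorm.ofBlocks g (liftBlk blk ι)) S (fun y y' => β * Real.exp (-(δ * g.dist y y'))))
    (hSD : ∀ μ, HasMaj (BlockNorm.ofBlocks g (liftBlk blk ι)) (BlockNorm.ofBlocks g (liftBlk blk ι)) (SD μ) (fun y y' => β * Real.exp (-(δ * g.dist y y'))))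
    (hD₃' : HasMaj (BlockNorm.ofBlocks g (liftBlk (blk ∘ π) ι)) (BlockNorm.ofBlocks g (liftBlk (blk ∘ π) ι)) D₃' (fun y y' => β * Real.exp (-(δ * g.dist y y'))))
    (hDG : HasMaj (BlockNorm.ofBlocks g (liftBlk blk ι)) (BlockNorm.ofBlocks g (liftBlk (blk ∘ π) ι))
      (idef (pull (liftMap π ι)) (pull (liftMap π ι)) G' G) (fun y y' => m₀ * θ * Real.exp (-(δ * g.dist y y'))))
    (hDD : ∀ μ, HasMaj (BlockNorm.ofBlocks g (liftBlk blk ι)) (BlockNorm.ofBlocks g (liftBlk (blk ∘ π) ι))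
      (idef (pull (liftMap π ι)) (pull (liftMap π ι)) (D' μ) (D μ)) (fun y y' => m₀ * θ * Real.exp (-(δ * g.dist y y'))))
    (hDS : HasMaj (BlockNorm.ofBlocks g (liftBlk blk ι)) (BlockNorm.ofBlocks g (liftBlk (blk ∘ π) ι))
      (idef (pull (liftMap π ι)) (pull (liftMap π ι)) S' S) (fun y y' => m₀ * θ * Real.exp (-(δ * g.dist y y'))))
    (hDSD : ∀ μ, HasMaj (BlockNorm.ofBlocks g (liftBlk blk ι)) (BlockNorm.ofBlocks g (liftBlk (blk ∘ π) ι))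
      (idef (pull (liftMap π ι)) (pull (liftMap π ι)) (SD' μ) (SD μ)) (fun y y' => m₀ * θ * Real.exp (-(δ * g.dist y y'))))
    (hDD₃ : HasMaj (BlockNorm.ofBlocks g (liftBlk blk ι)) (BlockNorm.ofBlocks g (liftBlk (blk ∘ π) ι))
      (idef (pull (liftMap π ι)) (pull (liftMap π ι)) D₃' D₃) (fun y y' => m₀ * θ * Real.exp (-(δ * g.dist y y'))))
    {U' : (J → X' → 𝔄) × (J → X' → 𝔄) × (X' → 𝔄)} (hreg : (v1Bg 𝔄 J π M θ).Reg335 c35 α₀ U') :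
    (∀ j : Option (J ⊕ J), HasMaj (BlockNorm.ofBlocks g (liftBlk blk ι)) (BlockNorm.ofBlocks g (liftBlk (blk ∘ π) ι))
      (idef (pull (liftMap π ι)) (pull (liftMap π ι)) (projO j ∘ₗ bgPairM G' D' (v1coefC e η' U') (v1coefA e η' U'))
        (projO j ∘ₗ bgPairM G D (v1coefC e η (v1avg 𝔄 J π U')) (v1coefA e η (v1avg 𝔄 J π U'))))
      (fun y y' => bgConst β cr m₀ (gV1c35 J (basisConst e) c35) a₀ * θ * Real.exp (-((δ - σ) * g.dist y y')))) ∧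
    HasMaj (BlockNorm.ofBlocks g (liftBlk blk ι)) (BlockNorm.ofBlocks g (liftBlk (blk ∘ π) ι))
      (idef (pull (liftMap π ι)) (pull (liftMap π ι))
        (projO none ∘ₗ bgSourceV (stack G' D') (stack S' SD') (unstackM (v1coefC e η' U') (v1coefA e η' U')))
        (projO none ∘ₗ bgSourceV (stack G D) (stack S SD) (unstackM (v1coefC e η (v1avg 𝔄 J π U')) (v1coefA e η (v1avg 𝔄 J π U')))))
      (fun y y' => bgConst β cr m₀ (gV1c35 J (basisConst e) c35) a₀ * θ * Real.exp (-((δ - σ) * g.dist y y'))) ∧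
    HasMaj (BlockNorm.ofBlocks g (liftBlk blk ι)) (BlockNorm.ofBlocks g (liftBlk (blk ∘ π) ι))
      (idef (pull (liftMap π ι)) (pull (liftMap π ι)) (bgDerivedV (stack G' D') D₃' (unstackM (v1coefC e η' U') (v1coefA e η' U')))
        (bgDerivedV (stack G D) D₃ (unstackM (v1coefC e η (v1avg 𝔄 J π U')) (v1coefA e η (v1avg 𝔄 J π U')))))
      (fun y y' => bgConst1 β cr m₀ (gV1c35 J (basisConst e) c35) a₀ * θ * Real.exp (-((δ - σ) * g.dist y y'))) := by
  obtain ⟨hr₂0, hr₂a, hV, hV', hDV⟩ := v1_letters_of_reg335 e (g := g) blk π hη' hη'η hη1 hηθ hc35 hM hα₀ hMα ha₀1 hreg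
  set R : ℝ := 16 * Real.exp 1 * (1 + Fintype.card J) * basisConst e * (c35 * M * α₀) * (1 + Fintype.card (J ⊕ J)) with hR_def
  have hJJ0 : (0 : ℝ) ≤ 1 + Fintype.card (J ⊕ J) := by positivity
  have hR0 : 0 ≤ R := mul_nonneg hr₂0 hJJ0
  have hκ : 0 ≤ basisConst e := basisConst_nonneg e
  have hca : 0 ≤ c35 * a₀ := mul_nonneg hc35.le ha₀
  have hRa : R ≤ gV1c35 J (basisConst e) c35 * a₀ := by
    calc R ≤ 16 * Real.exp 1 * (1 + Fintype.card J) * basisConst e * c35 * a₀ * (1 + Fintype.card (J ⊕ J)) := mul_le_mul_of_nonneg_right hr₂a hJJ0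
      _ = (16 * Real.exp 1 * (1 + Fintype.card J) * (1 + Fintype.card (J ⊕ J)) * (c35 * a₀)) * basisConst e := by ring
      _ ≤ (16 * Real.exp 1 * (1 + Fintype.card J) * (1 + Fintype.card (J ⊕ J)) * (c35 * a₀)) * (1 + basisConst e) :=
          mul_le_mul_of_nonneg_left (by linarith) (by positivity)
      _ = gV1c35 J (basisConst e) c35 * a₀ := by unfold gV1c35; ring
  have hRθ : 16 * Real.exp 1 * (1 + Fintype.card J) * basisConst e * (c35 * M * α₀) * θ * (1 + Fintype.card (J ⊕ J)) = R * θ := by rw [hR_def]; ring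
  rw [hRθ] at hDV
  have hK : 0 ≤ gV1c35 J (basisConst e) c35 := (le_gV1c35 (J := J) hκ hc35).2.le
  exact hasMaj_entries_of_letters (liftBlk blk ι) (liftMap π ι) htri hd hσ hcr hrow hσδ hβ hm₀ hθ hK ha₀ hq hR0 hRa hG hD hG' hD' hS hSD hD₃' hDG hDD
    hDS hDSD hDD₃ hV hV' hDV

end Guard

/-! ## §2 The kernel family, `EtaRateIneq342` per index, `NE2PlusOperator` BY NAME with `V′₁(A)` live -/

section Readout

variable {X X' J ι : Type} [Fintype X] [Fintype X'] [Fintype J] [Fintype ι] [DecidableEq X] [DecidableEq X'] [DecidableEq J] [DecidableEq ι]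
  {𝔄 : Type} [NormedRing 𝔄] [NormedAlgebra ℝ 𝔄] [CompleteSpace 𝔄] (e : 𝔄 ≃L[ℝ] (ι → ℝ)) {g : B6.Geometry} (blk : X → g.Site) (π : X' → X)

/-- THE FOUR ENTRY OPERATORS at a configuration `U′ = (A⁺, A⁻, W)` (fine spacing `η′`, coarse spacing `η`), all CONSTRUCTED from the `U ≡ 1` pieces on the product
carrier (derived pieces on `J ⊕ J`) and the DERIVED `V′₁` coefficients. [cite: Balaban1985BackgroundPropagators, (3.42) p.397 (the four entries: shape); (3.52) p.400 (shape)] -/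
def v1Ops4 (η η' : ℝ) (ν : J ⊕ J) (G S D₃ : (X × ι → ℝ) →ₗ[ℝ] (X × ι → ℝ)) (D SD : J ⊕ J → (X × ι → ℝ) →ₗ[ℝ] (X × ι → ℝ))
    (G' S' D₃' : (X' × ι → ℝ) →ₗ[ℝ] (X' × ι → ℝ)) (D' SD' : J ⊕ J → (X' × ι → ℝ) →ₗ[ℝ] (X' × ι → ℝ)) :
    Fin 4 → (J → X' → 𝔄) × (J → X' → 𝔄) × (X' → 𝔄) → ((X × ι → ℝ) →ₗ[ℝ] (X' × ι → ℝ)) :=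
  fun n U' => ![idef (pull (liftMap π ι)) (pull (liftMap π ι)) (projO none ∘ₗ bgPairM G' D' (v1coefC e η' U') (v1coefA e η' U'))
      (projO none ∘ₗ bgPairM G D (v1coefC e η (v1avg 𝔄 J π U')) (v1coefA e η (v1avg 𝔄 J π U'))),
    idef (pull (liftMap π ι)) (pull (liftMap π ι)) (projO (some ν) ∘ₗ bgPairM G' D' (v1coefC e η' U') (v1coefA e η' U'))
      (projO (some ν) ∘ₗ bgPairM G D (v1coefC e η (v1avg 𝔄 J π U')) (v1coefA e η (v1avg 𝔄 J π U'))),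
    idef (pull (liftMap π ι)) (pull (liftMap π ι))
      (projO none ∘ₗ bgSourceV (stack G' D') (stack S' SD') (unstackM (v1coefC e η' U') (v1coefA e η' U')))
      (projO none ∘ₗ bgSourceV (stack G D) (stack S SD) (unstackM (v1coefC e η (v1avg 𝔄 J π U')) (v1coefA e η (v1avg 𝔄 J π U')))),
    idef (pull (liftMap π ι)) (pull (liftMap π ι)) (bgDerivedV (stack G' D') D₃' (unstackM (v1coefC e η' U') (v1coefA e η' U')))
      (bgDerivedV (stack G D) D₃ (unstackM (v1coefC e η (v1avg 𝔄 J π U')) (v1coefA e η (v1avg 𝔄 J π U'))))] n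

/-- THE KERNEL FAMILY over the `V′₁` carrier (g0 `opFamily` on the product carrier), spacings `η = g.eta`, `η′ = η·(L^n)⁻¹`. [cite: Balaban1985BackgroundPropagators, (3.42) p.397 (shape)] -/
def v1Family4 (n : ℕ) (hL : g.L ≠ 0) (θc θ : ℝ) (ν : J ⊕ J) (G S D₃ : (X × ι → ℝ) →ₗ[ℝ] (X × ι → ℝ)) (D SD : J ⊕ J → (X × ι → ℝ) →ₗ[ℝ] (X × ι → ℝ))
    (G' S' D₃' : (X' × ι → ℝ) →ₗ[ℝ] (X' × ι → ℝ)) (D' SD' : J ⊕ J → (X' × ι → ℝ) →ₗ[ℝ] (X' × ι → ℝ)) :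
    B9.KernelFamily (v1Instance 𝔄 J ι blk π n hL θc θ).gc (v1Instance 𝔄 J ι blk π n hL θc θ).Bf :=
  show B9.KernelFamily (opGeo g (X × ι) (liftBlk blk ι)) (v1Bg 𝔄 J π g.M θ) from
    opFamily (g := g) (B := v1Bg 𝔄 J π g.M θ) (liftBlk blk ι) (liftBlk (blk ∘ π) ι) (v1Ops4 e π g.eta (g.eta * (g.L ^ n)⁻¹) ν G S D₃ D SD G' S' D₃' D' SD')

variable {G S D₃ : (X × ι → ℝ) →ₗ[ℝ] (X × ι → ℝ)} {D SD : J ⊕ J → (X × ι → ℝ) →ₗ[ℝ] (X × ι → ℝ)} {G' S' D₃' : (X' × ι → ℝ) →ₗ[ℝ] (X' × ι → ℝ)}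
  {D' SD' : J ⊕ J → (X' × ι → ℝ) →ₗ[ℝ] (X' × ι → ℝ)}

/-- **`EtaRateIneq342` PER INDEX WITH `V′₁(A)` LIVE, EXPLICIT CONSTANTS** (`B₀ = bgConst + bgConst1` at `gV1c35`, `δ₀ = δ − σ`), for every `Reg335`-regular `(A⁺, A⁻, W)`
under the guard. [cite: Balaban1985BackgroundPropagators, Thm 3.1 (3.42) p.397 (shape, quantifier template)] -/
theorem etaRateIneq342_v1 (htri : Triangle254 g) (hd : ∀ a b : g.Site, 0 ≤ g.dist a b) {σ cr : ℝ} (hσ : 0 ≤ σ) (hcr : 0 ≤ cr) (hrow : RowSum g σ cr)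
    (hη : 0 < g.eta) (hL : 0 < g.L) (hlen : ∀ y, 1 ≤ g.len y) {δ β m₀ θ c35 a₀ M α₀ γ η' : ℝ}
    (hσδ : σ ≤ δ) (hβ : 0 ≤ β) (hm₀ : 0 ≤ m₀) (hθ : 0 ≤ θ) (hθγ : ∀ y, θ ≤ rateWeight g γ y) (hc35 : 0 < c35) (ha₀ : 0 ≤ a₀)
    (ha₀1 : 2 * (c35 * a₀) ≤ 1) (hq : β * (gV1c35 J (basisConst e) c35 * a₀) * cr ≤ 1 / 2) (hM : 1 ≤ M) (hα₀ : 0 < α₀) (hMα : M * α₀ ≤ a₀)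
    (hη' : 0 ≤ η') (hη'η : η' ≤ g.eta) (hη1 : g.eta ≤ 1) (hηθ : g.eta ≤ θ) {ν : J ⊕ J}
    (hG : HasMaj (BlockNorm.ofBlocks g (liftBlk blk ι)) (BlockNorm.ofBlocks g (liftBlk blk ι)) G (fun y y' => β * Real.exp (-(δ * g.dist y y'))))
    (hD : ∀ μ, HasMaj (BlockNorm.ofBlocks g (liftBlk blk ι)) (BlockNorm.ofBlocks g (liftBlk blk ι)) (D μ) (fun y y' => β * Real.exp (-(δ * g.dist y y'))))
    (hG' : HasMaj (BlockNorm.ofBlocks g (liftBlk (blk ∘ π) ι)) (BlockNorm.ofBlocks g (liftBlk (blk ∘ π) ι)) G' (fun y y' => β * Real.exp (-(δ * g.dist y y'))))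
    (hD' : ∀ μ, HasMaj (BlockNorm.ofBlocks g (liftBlk (blk ∘ π) ι)) (BlockNorm.ofBlocks g (liftBlk (blk ∘ π) ι)) (D' μ) (fun y y' => β * Real.exp (-(δ * g.dist y y'))))
    (hS : HasMaj (BlockNorm.ofBlocks g (liftBlk blk ι)) (BlockNorm.ofBlocks g (liftBlk blk ι)) S (fun y y' => β * Real.exp (-(δ * g.dist y y'))))
    (hSD : ∀ μ, HasMaj (BlockNorm.ofBlocks g (liftBlk blk ι)) (BlockNorm.ofBlocks g (liftBlk blk ι)) (SD μ) (fun y y' => β * Real.exp (-(δ * g.dist y y'))))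
    (hD₃' : HasMaj (BlockNorm.ofBlocks g (liftBlk (blk ∘ π) ι)) (BlockNorm.ofBlocks g (liftBlk (blk ∘ π) ι)) D₃' (fun y y' => β * Real.exp (-(δ * g.dist y y'))))
    (hDG : HasMaj (BlockNorm.ofBlocks g (liftBlk blk ι)) (BlockNorm.ofBlocks g (liftBlk (blk ∘ π) ι))
      (idef (pull (liftMap π ι)) (pull (liftMap π ι)) G' G) (fun y y' => m₀ * θ * Real.exp (-(δ * g.dist y y'))))
    (hDD : ∀ μ, HasMaj (BlockNorm.ofBlocks g (liftBlk blk ι)) (BlockNorm.ofBlocks g (liftBlk (blk ∘ π) ι))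
      (idef (pull (liftMap π ι)) (pull (liftMap π ι)) (D' μ) (D μ)) (fun y y' => m₀ * θ * Real.exp (-(δ * g.dist y y'))))
    (hDS : HasMaj (BlockNorm.ofBlocks g (liftBlk blk ι)) (BlockNorm.ofBlocks g (liftBlk (blk ∘ π) ι))
      (idef (pull (liftMap π ι)) (pull (liftMap π ι)) S' S) (fun y y' => m₀ * θ * Real.exp (-(δ * g.dist y y'))))
    (hDSD : ∀ μ, HasMaj (BlockNorm.ofBlocks g (liftBlk blk ι)) (BlockNorm.ofBlocks g (liftBlk (blk ∘ π) ι))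
      (idef (pull (liftMap π ι)) (pull (liftMap π ι)) (SD' μ) (SD μ)) (fun y y' => m₀ * θ * Real.exp (-(δ * g.dist y y'))))
    (hDD₃ : HasMaj (BlockNorm.ofBlocks g (liftBlk blk ι)) (BlockNorm.ofBlocks g (liftBlk (blk ∘ π) ι))
      (idef (pull (liftMap π ι)) (pull (liftMap π ι)) D₃' D₃) (fun y y' => m₀ * θ * Real.exp (-(δ * g.dist y y'))))
    {U' : (J → X' → 𝔄) × (J → X' → 𝔄) × (X' → 𝔄)} (hreg : (v1Bg 𝔄 J π M θ).Reg335 c35 α₀ U') :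
    EtaRateIneq342 (opFamily (g := g) (B := v1Bg 𝔄 J π M θ) (liftBlk blk ι) (liftBlk (blk ∘ π) ι)
        (v1Ops4 e π g.eta η' ν G S D₃ D SD G' S' D₃' D' SD'))
      (bgConst β cr m₀ (gV1c35 J (basisConst e) c35) a₀ + bgConst1 β cr m₀ (gV1c35 J (basisConst e) c35) a₀) (δ - σ) γ U' := by
  obtain ⟨h01, h2, h3⟩ := hasMaj_v1_entries e blk π htri hd hσ hcr hrow hσδ hβ hm₀ hθ hc35 ha₀ ha₀1 hq hM hα₀ hMα hη' hη'η hη1 hηθ hG hD hG' hD' hS hSD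
    hD₃' hDG hDD hDS hDSD hDD₃ hreg
  have hgc : 0 ≤ gV1c35 J (basisConst e) c35 := (le_gV1c35 (J := J) (basisConst_nonneg e) hc35).2.le
  have hC0 : 0 ≤ bgConst β cr m₀ (gV1c35 J (basisConst e) c35) a₀ := bgConst_nonneg hβ hcr hm₀ hgc ha₀
  have hC1 : 0 ≤ bgConst1 β cr m₀ (gV1c35 J (basisConst e) c35) a₀ := bgConst1_nonneg hβ hcr hm₀ hgc ha₀
  refine etaRateIneq342_of_hasMaj (g := g) (B := v1Bg 𝔄 J π M θ) (liftBlk blk ι) (liftBlk (blk ∘ π) ι) hη.le hL.le (add_nonneg hC0 hC1)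
    (v1Ops4 e π g.eta η' ν G S D₃ D SD G' S' D₃' D' SD') U' fun n => ?_
  have hdom0 := fun n (y y' : g.Site) =>
    entryMajorant_le_etaRateShape (X := X × ι) (liftBlk blk ι) hη hL hlen (δ₀ := δ - σ) hθ hθγ hC0 (le_add_of_nonneg_right hC1) n y y'
  have hdom1 := fun n (y y' : g.Site) =>
    entryMajorant_le_etaRateShape (X := X × ι) (liftBlk blk ι) hη hL hlen (δ₀ := δ - σ) hθ hθγ hC1 (le_add_of_nonneg_left hC0) n y y'
  fin_cases n
  · exact (h01 none).mono (hdom0 0)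
  · exact (h01 (some ν)).mono (hdom0 1)
  · exact h2.mono (hdom0 2)
  · exact h3.mono (hdom1 3)

end Readout

section Node

variable {I J ι : Type} [Fintype J] [DecidableEq J] [Fintype ι] [DecidableEq ι] {𝔄 : Type} [NormedRing 𝔄] [NormedAlgebra ℝ 𝔄] [CompleteSpace 𝔄]
  (e : 𝔄 ≃L[ℝ] (ι → ℝ)) (g : I → B6.Geometry) (X X' : I → Type) [∀ i, Fintype (X i)] [∀ i, Fintype (X' i)] [∀ i, DecidableEq (X i)]
  [∀ i, DecidableEq (X' i)] (blk : ∀ i, X i → (g i).Site) (π : ∀ i, X' i → X i) (nsh : I → ℕ) (hL0 : ∀ i, (g i).L ≠ 0) (θc θ : I → ℝ) (ν : I → J ⊕ J)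
  (G S D₃ : ∀ i, (X i × ι → ℝ) →ₗ[ℝ] (X i × ι → ℝ)) (D SD : ∀ i, J ⊕ J → (X i × ι → ℝ) →ₗ[ℝ] (X i × ι → ℝ))
  (G' S' D₃' : ∀ i, (X' i × ι → ℝ) →ₗ[ℝ] (X' i × ι → ℝ)) (D' SD' : ∀ i, J ⊕ J → (X' i × ι → ℝ) →ₗ[ℝ] (X' i × ι → ℝ))

/-- **NE2⁺, OPERATOR LAYER — `T4EtaRate.NE2PlusOperator` BY NAME WITH THE PRINT's OWN `V′₁(A)` OF (3.52) LIVE, ALL FOUR ENTRIES CONSTRUCTED, ONLY THE `U ≡ 1` LAYER ON THE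
FORWARD∕BACKWARD STACK DISPLAYED.**  For ANY family — [B6] carriers with (2.54), `d ≥ 0`, uniform (2.61) `(σ, c_r)`, `0 < η ≤ min(1, θ_i)`, `L ≥ 1`, sites of size `≥ 1`;
directions `J`, `𝔤` modelled by `𝔄 ≅ ℝ^ι` with coordinates `e`; the `U ≡ 1` LAYER ON THE PRODUCT CARRIERS with derived pieces `D_i : J ⊕ J → …` (forward AND backward
derivative pieces) and UNIFORM letters (majorants `β·e^{−δd}`, `σ < δ`; η-defects `m₀·θ_i·e^{−δd}`; `θ_i ≤ (L^j)^{−γ}`, `γ > 0`); `c₃₅ > 0` —: the realised instances over the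
`V′₁` carriers (configurations `(A⁺, A⁻, W)`, `Reg335` = the (3.35) letter pair on each in the norm of `𝔄`, transport = fibrewise means, guard = the datum's `M`) with the
kernel families `v1Family4` satisfy `NE2PlusOperator c₃₅`, with `M₅ = 1`, `a₀ = (2·gV1c35·(βc_r + 1))⁻¹`, `B₀ = bgConst + bgConst1 + 1`, `δ₀ = δ − σ`; (3.35) CONSUMED on
the three input fields of `V′₁(A)`. [cite: Balaban1985BackgroundPropagators, Thm 3.1 p.397 (quantifier template); (3.35) p.396, (3.42) + (3.44) p.397, (3.52) p.400, (3.63)–(3.65) pp.402–403 (shapes, mechanism)] -/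
theorem ne2PlusOperator_v1 (c35 : ℝ) (hc35 : 0 < c35)
    (htri : ∀ i, Triangle254 (g i)) (hd : ∀ i (a b : (g i).Site), 0 ≤ (g i).dist a b) {σ cr : ℝ} (hσ : 0 ≤ σ) (hcr : 0 ≤ cr)
    (hrow : ∀ i, RowSum (g i) σ cr) (hη : ∀ i, 0 < (g i).eta) (hη1 : ∀ i, (g i).eta ≤ 1) (hηθ : ∀ i, (g i).eta ≤ θ i) (hL : ∀ i, 1 ≤ (g i).L)
    (hlen : ∀ i y, 1 ≤ (g i).len y) {δ β m₀ γ : ℝ} (hσδ : σ < δ) (hβ : 0 ≤ β) (hm₀ : 0 ≤ m₀) (hγ : 0 < γ) (hθγ : ∀ i y, θ i ≤ rateWeight (g i) γ y)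
    (hG : ∀ i, HasMaj (BlockNorm.ofBlocks (g i) (liftBlk (blk i) ι)) (BlockNorm.ofBlocks (g i) (liftBlk (blk i) ι)) (G i)
      (fun y y' => β * Real.exp (-(δ * (g i).dist y y'))))
    (hD : ∀ i μ, HasMaj (BlockNorm.ofBlocks (g i) (liftBlk (blk i) ι)) (BlockNorm.ofBlocks (g i) (liftBlk (blk i) ι)) (D i μ)
      (fun y y' => β * Real.exp (-(δ * (g i).dist y y'))))
    (hG' : ∀ i, HasMaj (BlockNorm.ofBlocks (g i) (liftBlk (blk i ∘ π i) ι)) (BlockNorm.ofBlocks (g i) (liftBlk (blk i ∘ π i) ι)) (G' i)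
      (fun y y' => β * Real.exp (-(δ * (g i).dist y y'))))
    (hD' : ∀ i μ, HasMaj (BlockNorm.ofBlocks (g i) (liftBlk (blk i ∘ π i) ι)) (BlockNorm.ofBlocks (g i) (liftBlk (blk i ∘ π i) ι)) (D' i μ)
      (fun y y' => β * Real.exp (-(δ * (g i).dist y y'))))
    (hS : ∀ i, HasMaj (BlockNorm.ofBlocks (g i) (liftBlk (blk i) ι)) (BlockNorm.ofBlocks (g i) (liftBlk (blk i) ι)) (S i)
      (fun y y' => β * Real.exp (-(δ * (g i).dist y y'))))
    (hSD : ∀ i μ, HasMaj (BlockNorm.ofBlocks (g i) (liftBlk (blk i) ι)) (BlockNorm.ofBlocks (g i) (liftBlk (blk i) ι)) (SD i μ)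
      (fun y y' => β * Real.exp (-(δ * (g i).dist y y'))))
    (hD₃' : ∀ i, HasMaj (BlockNorm.ofBlocks (g i) (liftBlk (blk i ∘ π i) ι)) (BlockNorm.ofBlocks (g i) (liftBlk (blk i ∘ π i) ι)) (D₃' i)
      (fun y y' => β * Real.exp (-(δ * (g i).dist y y'))))
    (hDG : ∀ i, HasMaj (BlockNorm.ofBlocks (g i) (liftBlk (blk i) ι)) (BlockNorm.ofBlocks (g i) (liftBlk (blk i ∘ π i) ι))
      (idef (pull (liftMap (π i) ι)) (pull (liftMap (π i) ι)) (G' i) (G i)) (fun y y' => m₀ * θ i * Real.exp (-(δ * (g i).dist y y'))))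
    (hDD : ∀ i μ, HasMaj (BlockNorm.ofBlocks (g i) (liftBlk (blk i) ι)) (BlockNorm.ofBlocks (g i) (liftBlk (blk i ∘ π i) ι))
      (idef (pull (liftMap (π i) ι)) (pull (liftMap (π i) ι)) (D' i μ) (D i μ)) (fun y y' => m₀ * θ i * Real.exp (-(δ * (g i).dist y y'))))
    (hDS : ∀ i, HasMaj (BlockNorm.ofBlocks (g i) (liftBlk (blk i) ι)) (BlockNorm.ofBlocks (g i) (liftBlk (blk i ∘ π i) ι))
      (idef (pull (liftMap (π i) ι)) (pull (liftMap (π i) ι)) (S' i) (S i)) (fun y y' => m₀ * θ i * Real.exp (-(δ * (g i).dist y y'))))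
    (hDSD : ∀ i μ, HasMaj (BlockNorm.ofBlocks (g i) (liftBlk (blk i) ι)) (BlockNorm.ofBlocks (g i) (liftBlk (blk i ∘ π i) ι))
      (idef (pull (liftMap (π i) ι)) (pull (liftMap (π i) ι)) (SD' i μ) (SD i μ)) (fun y y' => m₀ * θ i * Real.exp (-(δ * (g i).dist y y'))))
    (hDD₃ : ∀ i, HasMaj (BlockNorm.ofBlocks (g i) (liftBlk (blk i) ι)) (BlockNorm.ofBlocks (g i) (liftBlk (blk i ∘ π i) ι))
      (idef (pull (liftMap (π i) ι)) (pull (liftMap (π i) ι)) (D₃' i) (D₃ i)) (fun y y' => m₀ * θ i * Real.exp (-(δ * (g i).dist y y')))) :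
    NE2PlusOperator c35 (fun i => v1Instance 𝔄 J ι (blk i) (π i) (nsh i) (hL0 i) (θc i) (θ i))
      (fun i => v1Family4 e (blk i) (π i) (nsh i) (hL0 i) (θc i) (θ i) (ν i) (G i) (S i) (D₃ i) (D i) (SD i) (G' i) (S' i) (D₃' i) (D' i) (SD' i)) := by
  obtain ⟨hcg, hgpos⟩ := le_gV1c35 (J := J) (basisConst_nonneg e) hc35
  set a₀ : ℝ := (2 * gV1c35 J (basisConst e) c35 * (β * cr + 1))⁻¹ with ha₀_def
  have hden : 0 < 2 * gV1c35 J (basisConst e) c35 * (β * cr + 1) := by positivity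
  have ha₀ : 0 < a₀ := inv_pos.2 hden
  have hq : β * (gV1c35 J (basisConst e) c35 * a₀) * cr ≤ 1 / 2 := by
    have h1 : β * (gV1c35 J (basisConst e) c35 * a₀) * cr = (β * cr) * (gV1c35 J (basisConst e) c35 * a₀) := by ring
    have h2 : gV1c35 J (basisConst e) c35 * a₀ = (2 * (β * cr + 1))⁻¹ := by
      rw [ha₀_def]; field_simp
    rw [h1, h2, ← div_eq_mul_inv, div_le_iff₀ (by positivity)]
    nlinarith [mul_nonneg hβ hcr]
  have ha₀1 : 2 * (c35 * a₀) ≤ 1 := by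
    have h2 : 2 * (c35 * a₀) = c35 / (gV1c35 J (basisConst e) c35 * (β * cr + 1)) := by
      rw [ha₀_def]; field_simp
    rw [h2, div_le_one (by positivity)]
    nlinarith [mul_nonneg hβ hcr, hgpos]
  have hC0 : 0 ≤ bgConst β cr m₀ (gV1c35 J (basisConst e) c35) a₀ := bgConst_nonneg hβ hcr hm₀ hgpos.le ha₀.le
  have hC1 : 0 ≤ bgConst1 β cr m₀ (gV1c35 J (basisConst e) c35) a₀ := bgConst1_nonneg hβ hcr hm₀ hgpos.le ha₀.le
  refine ⟨1, δ - σ, a₀, bgConst β cr m₀ (gV1c35 J (basisConst e) c35) a₀ + bgConst1 β cr m₀ (gV1c35 J (basisConst e) c35) a₀ + 1, γ, one_pos, by linarith,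
    ha₀, by linarith, hγ, fun i hM α₀ hα₀ hMα U' hreg => ?_⟩
  have hM' : 1 ≤ (g i).M := hM
  have hMα' : (g i).M * α₀ ≤ a₀ := hMα
  have hLpos : 0 < (g i).L := lt_of_lt_of_le one_pos (hL i)
  have hη'0 : 0 ≤ (g i).eta * ((g i).L ^ nsh i)⁻¹ := mul_nonneg (hη i).le (inv_nonneg.2 (pow_nonneg hLpos.le _))
  have hη'η : (g i).eta * ((g i).L ^ nsh i)⁻¹ ≤ (g i).eta := by
    have h1 : ((g i).L ^ nsh i)⁻¹ ≤ 1 := inv_le_one_of_one_le₀ (one_le_pow₀ (hL i))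
    calc (g i).eta * ((g i).L ^ nsh i)⁻¹ ≤ (g i).eta * 1 := mul_le_mul_of_nonneg_left h1 (hη i).le
      _ = (g i).eta := mul_one _
  have hθ0 : 0 ≤ θ i := (hη i).le.trans (hηθ i)
  have key := etaRateIneq342_v1 e (J := J) (blk i) (π i) (htri i) (hd i) hσ hcr (hrow i) (hη i) hLpos (hlen i) hσδ.le hβ hm₀ hθ0 (hθγ i) hc35
    ha₀.le ha₀1 hq hM' hα₀ hMα' hη'0 hη'η (hη1 i) (hηθ i) (ν := ν i) (hG i) (hD i) (hG' i) (hD' i) (hS i) (hSD i) (hD₃' i) (hDG i) (hDD i) (hDS i)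
    (hDSD i) (hDD₃ i) hreg
  intro n lam y y' hs
  refine (key n lam y y' hs).trans ?_
  have hpref : 0 ≤ B9.pref4 ((v1Instance 𝔄 J ι (blk i) (π i) (nsh i) (hL0 i) (θc i) (θ i)).gc.len y) n := by
    have : 1 ≤ B9.pref4 ((opGeo (g i) (X i × ι) (liftBlk (blk i) ι)).len y) n := by rw [opGeo_len]; exact one_le_pref4 (hlen i y) n
    exact zero_le_one.trans this
  have hrf : 0 ≤ max (rateFactor (v1Instance 𝔄 J ι (blk i) (π i) (nsh i) (hL0 i) (θc i) (θ i)).gc γ y)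
      (rateFactor (v1Instance 𝔄 J ι (blk i) (π i) (nsh i) (hL0 i) (θc i) (θ i)).gc γ y') :=
    (T4EtaRate.rateFactor_nonneg (g := opGeo (g i) (X i × ι) (liftBlk (blk i) ι)) (hη i).le hLpos.le γ y).trans (le_max_left _ _)
  have hnorm : 0 ≤ (v1Instance 𝔄 J ι (blk i) (π i) (nsh i) (hL0 i) (θc i) (θ i)).gc.supNorm lam := Real.iSup_nonneg fun x => abs_nonneg _
  have hE : 0 ≤ Real.exp (-((δ - σ) * (v1Instance 𝔄 J ι (blk i) (π i) (nsh i) (hL0 i) (θc i) (θ i)).gc.dist y y')) := Real.exp_nonneg _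
  exact mul_le_mul_of_nonneg_right (mul_le_mul_of_nonneg_right (mul_le_mul_of_nonneg_right
    (mul_le_mul_of_nonneg_right (le_add_of_nonneg_right zero_le_one) hpref) hE) hrf) hnorm

end Node

end Summit.QuantumFields.YangMills.BalabanUVNodes.N15.BackgroundLayer
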